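import Mathlib.Analysis.Calculus.ContDiff.Deriv
import Mathlib.Analysis.Calculus.FDeriv.Analytic
import Mathlib.Analysis.Calculus.Deriv.Polynomial
import Mathlib.Analysis.Calculus.ContDiff.Polynomial
import Mathlib.RingTheory.Algebraic.Integral
import Literature.NumberTheory.Transcendental.SemialgebraicDerivativeProofs
import Literature.NumberTheory.Transcendental.SemialgebraicLineDeriv
import Literature.NumberTheory.Transcendental.KZSemialgebraicComplex
import Literature.NumberTheory.Transcendental.KZBallPeelingAux
import Mathlib.Analysis.Calculus.Deriv.Mul
import Mathlib.Analysis.Calculus.Deriv.Pow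
import Mathlib.Analysis.Calculus.Deriv.Add
import HarnessLib

/-!
# `DilationTransfer` in dimension `≤ 1` — I. Primitives of Nash functions under a functional relation

Support file for crux `DilationTransfer` (stmt-KontsevichZagierPeriods-3572, route `LiftingCriteria`).

Let `𝒮` be the class of real functions that are `C^∞` on `I = (0,1)` and whose graph over `I` is
`ℚ`-semialgebraic ("Nash on `(0,1)`"). It is local on `I` and stable under sums, real-algebraic
scalars, multiplication by `x`, and `d/dx` (Basu–Pollack–Roy Prop. 3.22, tree theorem
`IsSemialgebraicFunOn.hasDerivAt_isSemialgebraic_holds`).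
**Key lemma** (`mem_of_sum_pow_mul_mem`, stated for any such class `S` local on an open `I`): if
`w₀, …, w_D` are differentiable on `I` with ALL derivatives `w_e' ∈ S`, and
`x ↦ Σ_{e ≤ D} x^e · w_e(x)` lies in `S`, then every `w_e` lies in `S` — induction on `D`:
differentiating and using `[d/dx, x] = 1` gives a degree-`D − 1` combination of the `(e+1)·w_{e+1}`,
and characteristic `0` divides `e + 1` back out. (Polynomial-coefficient relations among primitives
of Nash functions, modulo Nash functions, are trivial.)
**Main result** (`stub_dimOnePrimitiveNash`): if `Pᵢ`, `Qⱼ` are primitives on `(0,1)` of Nash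
functions `γᵢ`, `Γⱼ` and satisfy the PRIMITIVE FORM of the dilation functional relation
`m₀ x + Σ mᵢ Pᵢ(x) = (x − ϖ₀)(x μ₀(x) + Σ μⱼ(x) Qⱼ(x))` on `(0,1)` (polynomials `μ` with
real-algebraic coefficients, `ϖ₀ ∈ ℚ`), then `x ↦ m₀ x + Σ mᵢ Pᵢ(x)` is itself Nash on `(0,1)`:
expanding `(x − ϖ₀)μⱼ(x) = Σ_e c_{j,e} x^e` the relation reads `Σ_e x^e w_e ∈ 𝒮` with
`w_e ∈ span{Pᵢ, Qⱼ}`, the key lemma gives every `w_e ∈ 𝒮`, and `Σ_e ϖ₀^e w_e = Σ mᵢ Pᵢ` because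
`(x − ϖ₀)μⱼ` vanishes at `ϖ₀`. This is the dimension-one dilation module made explicit: with
`v_g(ϖ) = ∫₀¹ g(ϖz)dz = P_g(ϖ)/ϖ`, functional relations among dilation functions are relations among
primitives, and they force the relevant primitive to be semialgebraic — legal Newton–Leibniz data.

## References
* S. Basu, R. Pollack, M.-F. Roy, *Algorithms in Real Algebraic Geometry* (2006), Prop. 3.22.
* M. Kontsevich, D. Zagier, *Periods* (2001), §1.2.
-/

noncomputable section

open scoped BigOperators ContDiff
open Set Polynomial
open Literature.NumberTheory.Transcendental
open Literature.ModelTheory.ExponentialFields (IsSemialgebraic)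

namespace Summit.KontsevichZagierPeriods.LiftingCriteria.DilationTransferDimOne

/-! Throughout, the class `𝒮` of functions "Nash on `(0,1)`" is written out as the set
`{h : ℝ → ℝ | ContDiffOn ℝ ∞ h (Set.Ioo 0 1) ∧ IsSemialgebraicFunOn ℚ {t | t 0 ∈ Set.Ioo 0 1} (fun t => h (t 0))}`
(no notation or definition is introduced). -/

/-! ### The key lemma (degree induction) -/

/-- **Key lemma (degree induction).** Let `S` be a class of real functions, local on the open set
`I`, containing `0`, stable under sums, rational scalars, multiplication by the coordinate and
differentiation, whose members are differentiable on `I`. If `w₀, …, w_D` are differentiable on `I`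
with derivatives in `S` and `x ↦ Σ_{e ≤ D} x^e · w_e(x)` lies in `S`, then every `w_e` (`e ≤ D`) lies
in `S`. [folklore] -/
theorem mem_of_sum_pow_mul_mem {I : Set ℝ} {S : Set (ℝ → ℝ)} (hI : IsOpen I)
    (hcongr : ∀ f ∈ S, ∀ g : ℝ → ℝ, EqOn g f I → g ∈ S) (hzero : (fun _ : ℝ => (0 : ℝ)) ∈ S)
    (hadd : ∀ f ∈ S, ∀ g ∈ S, (fun x => f x + g x) ∈ S)
    (hrat : ∀ (q : ℚ), ∀ f ∈ S, (fun x => (q : ℝ) * f x) ∈ S)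
    (hmulX : ∀ f ∈ S, (fun x => x * f x) ∈ S) (hderiv : ∀ f ∈ S, deriv f ∈ S) :
    ∀ (D : ℕ) (w : ℕ → ℝ → ℝ), (∀ e, DifferentiableOn ℝ (w e) I) → (∀ e, deriv (w e) ∈ S) →
      (fun x => ∑ e ∈ Finset.range (D + 1), x ^ e * w e x) ∈ S → ∀ e ≤ D, w e ∈ S := by
  -- derived closure properties of `S`
  have hsub : ∀ {f g : ℝ → ℝ}, f ∈ S → g ∈ S → (fun x => f x - g x) ∈ S := by
    intro f g hf hg
    have h := hadd f hf _ (hrat (-1) g hg)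
    exact hcongr _ h _ fun x _ => by push_cast; ring
  have hsum : ∀ (s : Finset ℕ) (f : ℕ → ℝ → ℝ), (∀ i ∈ s, f i ∈ S) → (fun x => ∑ i ∈ s, f i x) ∈ S := by
    intro s f hf
    induction s using Finset.induction_on with
    | empty => simpa using hzero
    | insert a s ha ih =>
      have h := hadd _ (hf a (Finset.mem_insert_self a s)) _
        (ih fun i hi => hf i (Finset.mem_insert_of_mem hi))
      exact hcongr _ h _ fun x _ => by simp [Finset.sum_insert ha]
  have hpow : ∀ (e : ℕ) {f : ℝ → ℝ}, f ∈ S → (fun x => x ^ e * f x) ∈ S := by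
    intro e f hf
    induction e with
    | zero => exact hcongr _ hf _ fun x _ => by simp
    | succ e ih =>
      have h := hmulX _ ih
      exact hcongr _ h _ fun x _ => by ring
  have hnat : ∀ (n : ℕ) {f : ℝ → ℝ}, f ∈ S → (fun x => (n : ℝ) * f x) ∈ S := by
    intro n f hf
    have h := hrat (n : ℚ) f hf
    exact hcongr _ h _ fun x _ => by push_cast; ring
  intro D
  induction D with
  | zero =>
    intro w _ _ hsumw e he
    obtain rfl : e = 0 := Nat.le_zero.mp he
    exact hcongr _ hsumw _ fun x _ => by simp
  | succ D ih =>
    intro w hwd hw' hsumw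
    -- the rescaled shifted family `w'_e = (e + 1) · w_{e+1}`
    set w' : ℕ → ℝ → ℝ := fun e x => ((e : ℝ) + 1) * w (e + 1) x with hw'def
    have hw'd : ∀ e, DifferentiableOn ℝ (w' e) I := fun e =>
      (differentiableOn_const _).mul (hwd (e + 1))
    have hw'deriv : ∀ e, deriv (w' e) = fun x => ((e : ℝ) + 1) * deriv (w (e + 1)) x := fun e =>
      deriv_const_mul_field' ((e : ℝ) + 1)
    have hw'S : ∀ e, deriv (w' e) ∈ S := by
      intro e
      rw [hw'deriv e]
      have h := hnat (e + 1) (hw' (e + 1))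
      exact hcongr _ h _ fun x _ => by push_cast; ring
    -- the derivative of the combination, computed on `I`
    have hD : ∀ x ∈ I, deriv (fun x => ∑ e ∈ Finset.range (D + 1 + 1), x ^ e * w e x) x =
        (∑ e ∈ Finset.range (D + 1), x ^ e * w' e x) +
          ∑ e ∈ Finset.range (D + 1 + 1), x ^ e * deriv (w e) x := by
      intro x hx
      have hwx : ∀ e, HasDerivAt (w e) (deriv (w e) x) x := fun e =>
        ((hwd e).differentiableAt (hI.mem_nhds hx)).hasDerivAt
      have hterm : ∀ e ∈ Finset.range (D + 1 + 1), HasDerivAt (fun x => x ^ e * w e x)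
          ((e : ℝ) * x ^ (e - 1) * w e x + x ^ e * deriv (w e) x) x := fun e _ =>
        (hasDerivAt_pow e x).mul (hwx e)
      rw [(HasDerivAt.fun_sum hterm).deriv, Finset.sum_add_distrib]
      congr 1
      rw [Finset.sum_range_succ' (fun e => (e : ℝ) * x ^ (e - 1) * w e x)]
      simp only [Nat.cast_zero, zero_mul, add_zero, Nat.cast_succ, Nat.add_sub_cancel, hw'def]
      refine Finset.sum_congr rfl fun e _ => ?_
      ring
    -- hence the degree-`D` combination of the `w'_e` lies in `S`
    have hsum' : (fun x => ∑ e ∈ Finset.range (D + 1), x ^ e * w' e x) ∈ S := by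
      have h1 := hderiv _ hsumw
      have h2 := hsum (Finset.range (D + 1 + 1)) (fun e x => x ^ e * deriv (w e) x)
        fun e _ => hpow e (hw' e)
      refine hcongr _ (hsub h1 h2) _ fun x hx => ?_
      simp only [hD x hx, add_sub_cancel_right]
    have hih := ih w' hw'd hw'S hsum'
    -- `w_{e+1} = (e+1)⁻¹ · w'_e ∈ S` for `e ≤ D`
    have hsucc : ∀ e ≤ D, w (e + 1) ∈ S := by
      intro e he
      have h := hrat ((e + 1 : ℚ)⁻¹) _ (hih e he)
      refine hcongr _ h _ fun x _ => ?_
      have hne : ((e : ℝ) + 1) ≠ 0 := by positivity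
      simp only [hw'def]
      push_cast
      field_simp
    intro e he
    rcases Nat.eq_zero_or_pos e with rfl | hpos
    · -- `w₀ = (Σ_{e ≤ D+1} x^e w_e) − Σ_{1 ≤ e ≤ D+1} x^e w_e`
      have h2 := hsum (Finset.range (D + 1)) (fun e x => x ^ (e + 1) * w (e + 1) x)
        fun e he' => hpow (e + 1) (hsucc e (Nat.lt_succ_iff.mp (Finset.mem_range.mp he')))
      refine hcongr _ (hsub hsumw h2) _ fun x _ => ?_
      simp only [Finset.sum_range_succ' (fun e => x ^ e * w e x), pow_zero, one_mul,
        add_sub_cancel_left]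
    · obtain ⟨e, rfl⟩ : ∃ e', e = e' + 1 := ⟨e - 1, by omega⟩
      exact hsucc e (by omega)

/-! ### The class `𝒮` and its closure properties -/

/-- The coordinate function is `ℚ`-semialgebraic on `(0,1)`. [folklore] -/
theorem isSemialgebraicFunOn_coord : IsSemialgebraicFunOn ℚ {t : Fin 1 → ℝ | t 0 ∈ Set.Ioo (0:ℝ) 1} fun t => t 0 := by
  simpa using isSemialgebraicFunOn_aeval KZ.BallPeeling.isSemialgebraic_posIoo (MvPolynomial.X 0 : MvPolynomial (Fin 1) ℚ)

/-- Locality of `𝒮`: membership only depends on the values on `(0,1)`. [folklore] -/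
theorem mem_S_congr {f g : ℝ → ℝ} (hf : f ∈ {h : ℝ → ℝ | ContDiffOn ℝ ∞ h (Set.Ioo (0:ℝ) 1) ∧ IsSemialgebraicFunOn ℚ {t : Fin 1 → ℝ | t 0 ∈ Set.Ioo (0:ℝ) 1} (fun t => h (t 0))}) (hfg : EqOn g f (Ioo 0 1)) : g ∈ {h : ℝ → ℝ | ContDiffOn ℝ ∞ h (Set.Ioo (0:ℝ) 1) ∧ IsSemialgebraicFunOn ℚ {t : Fin 1 → ℝ | t 0 ∈ Set.Ioo (0:ℝ) 1} (fun t => h (t 0))} :=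
  ⟨hf.1.congr hfg, hf.2.congr fun _ ht => (hfg ht).symm⟩

/-- `0 ∈ 𝒮`. [folklore] -/
theorem zero_mem_S : (fun _ : ℝ => (0 : ℝ)) ∈ {h : ℝ → ℝ | ContDiffOn ℝ ∞ h (Set.Ioo (0:ℝ) 1) ∧ IsSemialgebraicFunOn ℚ {t : Fin 1 → ℝ | t 0 ∈ Set.Ioo (0:ℝ) 1} (fun t => h (t 0))} :=
  ⟨contDiffOn_const, by simpa using isSemialgebraicFunOn_const_ratCast KZ.BallPeeling.isSemialgebraic_posIoo 0⟩

/-- `𝒮` is stable under sums. [folklore] -/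
theorem add_mem_S {f g : ℝ → ℝ} (hf : f ∈ {h : ℝ → ℝ | ContDiffOn ℝ ∞ h (Set.Ioo (0:ℝ) 1) ∧ IsSemialgebraicFunOn ℚ {t : Fin 1 → ℝ | t 0 ∈ Set.Ioo (0:ℝ) 1} (fun t => h (t 0))}) (hg : g ∈ {h : ℝ → ℝ | ContDiffOn ℝ ∞ h (Set.Ioo (0:ℝ) 1) ∧ IsSemialgebraicFunOn ℚ {t : Fin 1 → ℝ | t 0 ∈ Set.Ioo (0:ℝ) 1} (fun t => h (t 0))}) : (fun x => f x + g x) ∈ {h : ℝ → ℝ | ContDiffOn ℝ ∞ h (Set.Ioo (0:ℝ) 1) ∧ IsSemialgebraicFunOn ℚ {t : Fin 1 → ℝ | t 0 ∈ Set.Ioo (0:ℝ) 1} (fun t => h (t 0))} :=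
  ⟨hf.1.add hg.1, hf.2.fun_add hg.2⟩

/-- `𝒮` is stable under multiplication by real-algebraic constants. [folklore] -/
theorem constMul_mem_S {c : ℝ} (hc : IsAlgebraic ℚ c) {f : ℝ → ℝ} (hf : f ∈ {h : ℝ → ℝ | ContDiffOn ℝ ∞ h (Set.Ioo (0:ℝ) 1) ∧ IsSemialgebraicFunOn ℚ {t : Fin 1 → ℝ | t 0 ∈ Set.Ioo (0:ℝ) 1} (fun t => h (t 0))}) :
    (fun x => c * f x) ∈ {h : ℝ → ℝ | ContDiffOn ℝ ∞ h (Set.Ioo (0:ℝ) 1) ∧ IsSemialgebraicFunOn ℚ {t : Fin 1 → ℝ | t 0 ∈ Set.Ioo (0:ℝ) 1} (fun t => h (t 0))} :=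
  ⟨contDiffOn_const.mul hf.1, (isSemialgebraicFunOn_const_of_isAlgebraic KZ.BallPeeling.isSemialgebraic_posIoo hc).fun_mul hf.2⟩

/-- `𝒮` is stable under rational scalars. [folklore] -/
theorem ratMul_mem_S (q : ℚ) {f : ℝ → ℝ} (hf : f ∈ {h : ℝ → ℝ | ContDiffOn ℝ ∞ h (Set.Ioo (0:ℝ) 1) ∧ IsSemialgebraicFunOn ℚ {t : Fin 1 → ℝ | t 0 ∈ Set.Ioo (0:ℝ) 1} (fun t => h (t 0))}) : (fun x => (q : ℝ) * f x) ∈ {h : ℝ → ℝ | ContDiffOn ℝ ∞ h (Set.Ioo (0:ℝ) 1) ∧ IsSemialgebraicFunOn ℚ {t : Fin 1 → ℝ | t 0 ∈ Set.Ioo (0:ℝ) 1} (fun t => h (t 0))} :=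
  constMul_mem_S (by simpa using isAlgebraic_algebraMap (R := ℚ) (A := ℝ) q) hf

/-- `𝒮` is stable under multiplication by the coordinate. [folklore] -/
theorem mulX_mem_S {f : ℝ → ℝ} (hf : f ∈ {h : ℝ → ℝ | ContDiffOn ℝ ∞ h (Set.Ioo (0:ℝ) 1) ∧ IsSemialgebraicFunOn ℚ {t : Fin 1 → ℝ | t 0 ∈ Set.Ioo (0:ℝ) 1} (fun t => h (t 0))}) : (fun x => x * f x) ∈ {h : ℝ → ℝ | ContDiffOn ℝ ∞ h (Set.Ioo (0:ℝ) 1) ∧ IsSemialgebraicFunOn ℚ {t : Fin 1 → ℝ | t 0 ∈ Set.Ioo (0:ℝ) 1} (fun t => h (t 0))} :=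
  ⟨contDiffOn_id.mul hf.1, isSemialgebraicFunOn_coord.fun_mul hf.2⟩

/-- `𝒮` is stable under products. [folklore] -/
theorem mul_mem_S {f g : ℝ → ℝ} (hf : f ∈ {h : ℝ → ℝ | ContDiffOn ℝ ∞ h (Set.Ioo (0:ℝ) 1) ∧ IsSemialgebraicFunOn ℚ {t : Fin 1 → ℝ | t 0 ∈ Set.Ioo (0:ℝ) 1} (fun t => h (t 0))}) (hg : g ∈ {h : ℝ → ℝ | ContDiffOn ℝ ∞ h (Set.Ioo (0:ℝ) 1) ∧ IsSemialgebraicFunOn ℚ {t : Fin 1 → ℝ | t 0 ∈ Set.Ioo (0:ℝ) 1} (fun t => h (t 0))}) : (fun x => f x * g x) ∈ {h : ℝ → ℝ | ContDiffOn ℝ ∞ h (Set.Ioo (0:ℝ) 1) ∧ IsSemialgebraicFunOn ℚ {t : Fin 1 → ℝ | t 0 ∈ Set.Ioo (0:ℝ) 1} (fun t => h (t 0))} :=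
  ⟨hf.1.mul hg.1, hf.2.fun_mul hg.2⟩

/-- Members of `𝒮` are differentiable on `(0,1)`. [folklore] -/
theorem differentiableOn_of_mem_S {f : ℝ → ℝ} (hf : f ∈ {h : ℝ → ℝ | ContDiffOn ℝ ∞ h (Set.Ioo (0:ℝ) 1) ∧ IsSemialgebraicFunOn ℚ {t : Fin 1 → ℝ | t 0 ∈ Set.Ioo (0:ℝ) 1} (fun t => h (t 0))}) : DifferentiableOn ℝ f (Ioo 0 1) :=
  hf.1.differentiableOn (by simp)

/-- `𝒮` is stable under `d/dx`: smoothness by `ContDiffOn.deriv_of_isOpen`, semialgebraicity of the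
derivative by Basu–Pollack–Roy Prop. 3.22 (`IsSemialgebraicFunOn.hasDerivAt_isSemialgebraic_holds`).
[cite: BasuPollackRoy2006, Prop. 3.22] -/
theorem deriv_mem_S {f : ℝ → ℝ} (hf : f ∈ {h : ℝ → ℝ | ContDiffOn ℝ ∞ h (Set.Ioo (0:ℝ) 1) ∧ IsSemialgebraicFunOn ℚ {t : Fin 1 → ℝ | t 0 ∈ Set.Ioo (0:ℝ) 1} (fun t => h (t 0))}) : deriv f ∈ {h : ℝ → ℝ | ContDiffOn ℝ ∞ h (Set.Ioo (0:ℝ) 1) ∧ IsSemialgebraicFunOn ℚ {t : Fin 1 → ℝ | t 0 ∈ Set.Ioo (0:ℝ) 1} (fun t => h (t 0))} := by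
  refine ⟨hf.1.deriv_of_isOpen isOpen_Ioo le_rfl, ?_⟩
  exact IsSemialgebraicFunOn.hasDerivAt_isSemialgebraic_holds 0 1 f (deriv f) one_pos hf.2
    fun x hx => ((differentiableOn_of_mem_S hf).differentiableAt (isOpen_Ioo.mem_nhds hx)).hasDerivAt

/-- Polynomial functions with real-algebraic coefficients lie in `𝒮`. [folklore] -/
theorem eval_mem_S {p : ℝ[X]} (hp : ∀ k, IsAlgebraic ℚ (p.coeff k)) : (fun x => p.eval x) ∈ {h : ℝ → ℝ | ContDiffOn ℝ ∞ h (Set.Ioo (0:ℝ) 1) ∧ IsSemialgebraicFunOn ℚ {t : Fin 1 → ℝ | t 0 ∈ Set.Ioo (0:ℝ) 1} (fun t => h (t 0))} := by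
  refine ⟨?_, ?_⟩
  · have h := (Polynomial.contDiff_aeval p ∞ (𝕜 := ℝ)).contDiffOn (s := Ioo (0:ℝ) 1)
    exact h.congr fun x _ => by simp [Polynomial.coe_aeval_eq_eval]
  · have h : IsSemialgebraicFunOn ℚ {t : Fin 1 → ℝ | t 0 ∈ Set.Ioo (0:ℝ) 1} fun t => ∑ k ∈ Finset.range (p.natDegree + 1), p.coeff k * t 0 ^ k :=
      IsSemialgebraicFunOn.fun_finsetSum _ KZ.BallPeeling.isSemialgebraic_posIoo fun k _ =>
        (isSemialgebraicFunOn_const_of_isAlgebraic KZ.BallPeeling.isSemialgebraic_posIoo (hp k)).fun_mul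
          (isSemialgebraicFunOn_coord.fun_pow k)
    exact h.congr fun t _ => (eval_eq_sum_range' (Nat.lt_succ_self _) (t 0)).symm

/-- Nash functions on `(0,1)` (analytic with `ℚ`-semialgebraic graph) lie in `𝒮`. [folklore] -/
theorem mem_S_of_analyticOnNhd {γ : ℝ → ℝ} (ha : AnalyticOnNhd ℝ γ (Ioo 0 1))
    (hs : IsSemialgebraicFunOn ℚ {t : Fin 1 → ℝ | t 0 ∈ Set.Ioo (0:ℝ) 1} fun t => γ (t 0)) : γ ∈ {h : ℝ → ℝ | ContDiffOn ℝ ∞ h (Set.Ioo (0:ℝ) 1) ∧ IsSemialgebraicFunOn ℚ {t : Fin 1 → ℝ | t 0 ∈ Set.Ioo (0:ℝ) 1} (fun t => h (t 0))} :=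
  ⟨ha.contDiffOn isOpen_Ioo.uniqueDiffOn, hs⟩

/-- A primitive on `(0,1)` of a member of `𝒮` is `C^∞` there. [folklore] -/
theorem contDiffOn_of_hasDerivAt {P γ : ℝ → ℝ} (hγ : γ ∈ {h : ℝ → ℝ | ContDiffOn ℝ ∞ h (Set.Ioo (0:ℝ) 1) ∧ IsSemialgebraicFunOn ℚ {t : Fin 1 → ℝ | t 0 ∈ Set.Ioo (0:ℝ) 1} (fun t => h (t 0))})
    (hP : ∀ x ∈ Ioo (0:ℝ) 1, HasDerivAt P (γ x) x) : ContDiffOn ℝ ∞ P (Ioo 0 1) := by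
  rw [contDiffOn_infty_iff_deriv_of_isOpen isOpen_Ioo]
  refine ⟨fun x hx => (hP x hx).differentiableAt.differentiableWithinAt, ?_⟩
  exact hγ.1.congr fun x hx => (hP x hx).deriv

/-- `𝒮` is stable under differences. [folklore] -/
theorem sub_mem_S {f g : ℝ → ℝ} (hf : f ∈ {h : ℝ → ℝ | ContDiffOn ℝ ∞ h (Set.Ioo (0:ℝ) 1) ∧ IsSemialgebraicFunOn ℚ {t : Fin 1 → ℝ | t 0 ∈ Set.Ioo (0:ℝ) 1} (fun t => h (t 0))}) (hg : g ∈ {h : ℝ → ℝ | ContDiffOn ℝ ∞ h (Set.Ioo (0:ℝ) 1) ∧ IsSemialgebraicFunOn ℚ {t : Fin 1 → ℝ | t 0 ∈ Set.Ioo (0:ℝ) 1} (fun t => h (t 0))}) : (fun x => f x - g x) ∈ {h : ℝ → ℝ | ContDiffOn ℝ ∞ h (Set.Ioo (0:ℝ) 1) ∧ IsSemialgebraicFunOn ℚ {t : Fin 1 → ℝ | t 0 ∈ Set.Ioo (0:ℝ) 1} (fun t => h (t 0))} :=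
  ⟨hf.1.sub hg.1, hf.2.fun_sub hg.2⟩

/-- `𝒮` is stable under finite sums. [folklore] -/
theorem sum_mem_S {ι : Type*} (s : Finset ι) {f : ι → ℝ → ℝ} (hf : ∀ i ∈ s, f i ∈ {h : ℝ → ℝ | ContDiffOn ℝ ∞ h (Set.Ioo (0:ℝ) 1) ∧ IsSemialgebraicFunOn ℚ {t : Fin 1 → ℝ | t 0 ∈ Set.Ioo (0:ℝ) 1} (fun t => h (t 0))}) :
    (fun x => ∑ i ∈ s, f i x) ∈ {h : ℝ → ℝ | ContDiffOn ℝ ∞ h (Set.Ioo (0:ℝ) 1) ∧ IsSemialgebraicFunOn ℚ {t : Fin 1 → ℝ | t 0 ∈ Set.Ioo (0:ℝ) 1} (fun t => h (t 0))} :=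
  ⟨ContDiffOn.sum fun i hi => (hf i hi).1,
    IsSemialgebraicFunOn.fun_finsetSum s KZ.BallPeeling.isSemialgebraic_posIoo fun i hi => (hf i hi).2⟩

/-- The coordinate function lies in `𝒮`. [folklore] -/
theorem id_mem_S : (fun x : ℝ => x) ∈ {h : ℝ → ℝ | ContDiffOn ℝ ∞ h (Set.Ioo (0:ℝ) 1) ∧ IsSemialgebraicFunOn ℚ {t : Fin 1 → ℝ | t 0 ∈ Set.Ioo (0:ℝ) 1} (fun t => h (t 0))} :=
  ⟨contDiffOn_id, isSemialgebraicFunOn_coord⟩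

/-! ### The main result -/

/-- **Primitives of Nash functions under the dilation functional relation are Nash** (registered
sub-goal `stub_dimOnePrimitiveNash` of crux stmt-KontsevichZagierPeriods-3572). If `Pᵢ`, `Qⱼ` have
derivatives the Nash functions `γᵢ`, `Γⱼ` on `(0,1)` and
`m₀ x + Σ mᵢ Pᵢ(x) = (x − ϖ₀)(x μ₀(x) + Σ μⱼ(x) Qⱼ(x))` on `(0,1)` (`μ` with real-algebraic
coefficients, `ϖ₀ ∈ ℚ`), then `x ↦ m₀ x + Σ mᵢ Pᵢ(x)` has `ℚ`-semialgebraic graph over `(0,1)`.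
Proof: the key lemma in the class `𝒮`, then specialisation `Σ_e ϖ₀^e w_e`.
[cite: KontsevichZagier2001, §1.2] -/
theorem stub_dimOnePrimitiveNash :
    ∀ (S T : ℕ) (γ : Fin S → ℝ → ℝ) (Γ : Fin T → ℝ → ℝ) (P : Fin S → ℝ → ℝ) (Q : Fin T → ℝ → ℝ) (m : Fin S → ℤ) (m₀ : ℤ) (ϖ₀ : ℚ) (μ : Fin T → Polynomial ℝ) (μ₀ : Polynomial ℝ), (∀ i, AnalyticOnNhd ℝ (γ i) (Set.Ioo (0:ℝ) 1) ∧ Literature.NumberTheory.Transcendental.IsSemialgebraicFunOn ℚ {t : Fin 1 → ℝ | t 0 ∈ Set.Ioo (0:ℝ) 1} (fun t => γ i (t 0)) ∧ ∀ x ∈ Set.Ioo (0:ℝ) 1, HasDerivAt (P i) (γ i x) x) → (∀ j, AnalyticOnNhd ℝ (Γ j) (Set.Ioo (0:ℝ) 1) ∧ Literature.NumberTheory.Transcendental.IsSemialgebraicFunOn ℚ {t : Fin 1 → ℝ | t 0 ∈ Set.Ioo (0:ℝ) 1} (fun t => Γ j (t 0)) ∧ ∀ x ∈ Set.Ioo (0:ℝ)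 1, HasDerivAt (Q j) (Γ j x) x) → (∀ j k, IsAlgebraic ℚ ((μ j).coeff k)) → (∀ k, IsAlgebraic ℚ (μ₀.coeff k)) → (∀ x ∈ Set.Ioo (0:ℝ) 1, (m₀ : ℝ) * x + ∑ i, (m i : ℝ) * P i x = (x - (ϖ₀ : ℝ)) * (x * μ₀.eval x + ∑ j, (μ j).eval x * Q j x)) → Literature.NumberTheory.Transcendental.IsSemialgebraicFunOn ℚ {t : Fin 1 → ℝ | t 0 ∈ Set.Ioo (0:ℝ) 1} (fun t => (m₀ : ℝ) * t 0 + ∑ i, (m i : ℝ) * P i (t 0)) := by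
  intro S T γ Γ P Q m m₀ ϖ₀ μ μ₀ hγ hΓ hμ hμ₀ hrel
  -- members of `{h : ℝ → ℝ | ContDiffOn ℝ ∞ h (Set.Ioo (0:ℝ) 1) ∧ IsSemialgebraicFunOn ℚ {t : Fin 1 → ℝ | t 0 ∈ Set.Ioo (0:ℝ) 1} (fun t => h (t 0))}`
  have hγS : ∀ i, γ i ∈ {h : ℝ → ℝ | ContDiffOn ℝ ∞ h (Set.Ioo (0:ℝ) 1) ∧ IsSemialgebraicFunOn ℚ {t : Fin 1 → ℝ | t 0 ∈ Set.Ioo (0:ℝ) 1} (fun t => h (t 0))} := fun i => mem_S_of_analyticOnNhd (hγ i).1 (hγ i).2.1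
  have hΓS : ∀ j, Γ j ∈ {h : ℝ → ℝ | ContDiffOn ℝ ∞ h (Set.Ioo (0:ℝ) 1) ∧ IsSemialgebraicFunOn ℚ {t : Fin 1 → ℝ | t 0 ∈ Set.Ioo (0:ℝ) 1} (fun t => h (t 0))} := fun j => mem_S_of_analyticOnNhd (hΓ j).1 (hΓ j).2.1
  have hPd : ∀ i, DifferentiableOn ℝ (P i) (Ioo 0 1) := fun i x hx =>
    ((hγ i).2.2 x hx).differentiableAt.differentiableWithinAt
  have hQd : ∀ j, DifferentiableOn ℝ (Q j) (Ioo 0 1) := fun j x hx =>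
    ((hΓ j).2.2 x hx).differentiableAt.differentiableWithinAt
  -- the polynomials `νⱼ = (X − ϖ₀) μⱼ`, their coefficients, a common degree bound
  set ν : Fin T → ℝ[X] := fun j => (X - C (ϖ₀ : ℝ)) * μ j with hν
  have hνalg : ∀ j e, IsAlgebraic ℚ ((ν j).coeff e) := by
    intro j e
    cases e with
    | zero =>
      simp only [hν, sub_mul, coeff_sub, coeff_X_mul_zero, coeff_C_mul]
      exact isAlgebraic_zero.sub ((by simpa using isAlgebraic_algebraMap (R := ℚ) (A := ℝ) ϖ₀ : IsAlgebraic ℚ (ϖ₀ : ℝ)).mul (hμ j 0))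
    | succ e =>
      simp only [hν, sub_mul, coeff_sub, coeff_X_mul, coeff_C_mul]
      exact (hμ j e).sub ((by simpa using isAlgebraic_algebraMap (R := ℚ) (A := ℝ) ϖ₀ : IsAlgebraic ℚ (ϖ₀ : ℝ)).mul (hμ j _))
  have hνeval0 : ∀ j, (ν j).eval (ϖ₀ : ℝ) = 0 := fun j => by simp [hν]
  set D : ℕ := Finset.univ.sup fun j => (ν j).natDegree with hD
  have hνdeg : ∀ j, (ν j).natDegree < D + 1 := fun j =>
    Nat.lt_succ_of_le (Finset.le_sup (f := fun j => (ν j).natDegree) (Finset.mem_univ j))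
  have hνsum : ∀ j (x : ℝ), (ν j).eval x = ∑ e ∈ Finset.range (D + 1), (ν j).coeff e * x ^ e :=
    fun j x => eval_eq_sum_range' (hνdeg j) x
  -- the family `w_e` and its derivatives `w'_e`
  set w : ℕ → ℝ → ℝ := fun e x =>
    (if e = 0 then ∑ i, (m i : ℝ) * P i x else 0) - ∑ j, (ν j).coeff e * Q j x with hw
  set w' : ℕ → ℝ → ℝ := fun e x =>
    (if e = 0 then ∑ i, (m i : ℝ) * γ i x else 0) - ∑ j, (ν j).coeff e * Γ j x with hw'
  have hwd : ∀ e, DifferentiableOn ℝ (w e) (Ioo 0 1) := by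
    intro e
    refine DifferentiableOn.sub ?_
      (DifferentiableOn.fun_sum fun j _ => (differentiableOn_const _).mul (hQd j))
    split_ifs
    · exact DifferentiableOn.fun_sum fun i _ => (differentiableOn_const _).mul (hPd i)
    · exact differentiableOn_const _
  have hw'S : ∀ e, w' e ∈ {h : ℝ → ℝ | ContDiffOn ℝ ∞ h (Set.Ioo (0:ℝ) 1) ∧ IsSemialgebraicFunOn ℚ {t : Fin 1 → ℝ | t 0 ∈ Set.Ioo (0:ℝ) 1} (fun t => h (t 0))} := by
    intro e
    refine sub_mem_S ?_ (sum_mem_S _ fun j _ => constMul_mem_S (hνalg j e) (hΓS j))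
    split_ifs
    · exact sum_mem_S _ fun i _ => constMul_mem_S (isAlgebraic_int (m i)) (hγS i)
    · exact zero_mem_S
  have hww' : ∀ e, ∀ x ∈ Ioo (0:ℝ) 1, HasDerivAt (w e) (w' e x) x := by
    intro e x hx
    have h2 : HasDerivAt (fun x => ∑ j, (ν j).coeff e * Q j x) (∑ j, (ν j).coeff e * Γ j x) x :=
      HasDerivAt.fun_sum fun j _ => ((hΓ j).2.2 x hx).const_mul _
    refine HasDerivAt.sub ?_ h2
    split_ifs
    · exact HasDerivAt.fun_sum fun i _ => ((hγ i).2.2 x hx).const_mul _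
    · exact hasDerivAt_const x 0
  have hwderiv : ∀ e, deriv (w e) ∈ {h : ℝ → ℝ | ContDiffOn ℝ ∞ h (Set.Ioo (0:ℝ) 1) ∧ IsSemialgebraicFunOn ℚ {t : Fin 1 → ℝ | t 0 ∈ Set.Ioo (0:ℝ) 1} (fun t => h (t 0))} := fun e =>
    mem_S_congr (hw'S e) fun x hx => (hww' e x hx).deriv
  -- the combination `Σ_e x^e w_e = Σ mᵢ Pᵢ − Σⱼ νⱼ Qⱼ` is the polynomial `(x − ϖ₀) x μ₀(x) − m₀ x`
  have hcomb : ∀ x : ℝ, ∑ e ∈ Finset.range (D + 1), x ^ e * w e x =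
      ∑ i, (m i : ℝ) * P i x - ∑ j, (ν j).eval x * Q j x := by
    intro x
    simp only [hw, mul_sub, Finset.sum_sub_distrib, mul_ite, mul_zero, Finset.sum_ite_eq',
      Finset.mem_range, Nat.zero_lt_succ, if_true, pow_zero, one_mul]
    congr 1
    simp only [Finset.mul_sum]
    rw [Finset.sum_comm]
    refine Finset.sum_congr rfl fun j _ => ?_
    rw [hνsum j x, Finset.sum_mul]
    refine Finset.sum_congr rfl fun e _ => ?_
    ring
  have hpoly : (fun x => (x - (ϖ₀ : ℝ)) * (x * μ₀.eval x) - (m₀ : ℝ) * x) ∈ {h : ℝ → ℝ | ContDiffOn ℝ ∞ h (Set.Ioo (0:ℝ) 1) ∧ IsSemialgebraicFunOn ℚ {t : Fin 1 → ℝ | t 0 ∈ Set.Ioo (0:ℝ) 1} (fun t => h (t 0))} := by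
    have h1 : (fun x => x * μ₀.eval x) ∈ {h : ℝ → ℝ | ContDiffOn ℝ ∞ h (Set.Ioo (0:ℝ) 1) ∧ IsSemialgebraicFunOn ℚ {t : Fin 1 → ℝ | t 0 ∈ Set.Ioo (0:ℝ) 1} (fun t => h (t 0))} := mulX_mem_S (eval_mem_S hμ₀)
    have h2 : (fun x => (x - (ϖ₀ : ℝ)) * (x * μ₀.eval x)) ∈ {h : ℝ → ℝ | ContDiffOn ℝ ∞ h (Set.Ioo (0:ℝ) 1) ∧ IsSemialgebraicFunOn ℚ {t : Fin 1 → ℝ | t 0 ∈ Set.Ioo (0:ℝ) 1} (fun t => h (t 0))} :=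
      mem_S_congr (sub_mem_S (mulX_mem_S h1) (ratMul_mem_S ϖ₀ h1)) fun x _ => by ring
    exact sub_mem_S h2 (ratMul_mem_S (m₀ : ℚ) id_mem_S |> fun h => mem_S_congr h fun x _ => by push_cast; ring)
  have hsum : (fun x => ∑ e ∈ Finset.range (D + 1), x ^ e * w e x) ∈ {h : ℝ → ℝ | ContDiffOn ℝ ∞ h (Set.Ioo (0:ℝ) 1) ∧ IsSemialgebraicFunOn ℚ {t : Fin 1 → ℝ | t 0 ∈ Set.Ioo (0:ℝ) 1} (fun t => h (t 0))} := by
    refine mem_S_congr hpoly fun x hx => ?_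
    rw [hcomb x]
    have h := hrel x hx
    have hνx : ∀ j, (ν j).eval x = (x - (ϖ₀ : ℝ)) * (μ j).eval x := fun j => by simp [hν]
    simp only [hνx]
    rw [mul_add, Finset.mul_sum] at h
    have : ∑ j, (x - (ϖ₀ : ℝ)) * (μ j).eval x * Q j x = ∑ j, (x - (ϖ₀ : ℝ)) * ((μ j).eval x * Q j x) :=
      Finset.sum_congr rfl fun j _ => by ring
    rw [this]
    linarith
  -- the key lemma: every `w_e ∈ {h : ℝ → ℝ | ContDiffOn ℝ ∞ h (Set.Ioo (0:ℝ) 1) ∧ IsSemialgebraicFunOn ℚ {t : Fin 1 → ℝ | t 0 ∈ Set.Ioo (0:ℝ) 1} (fun t => h (t 0))}`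
  have hkey := mem_of_sum_pow_mul_mem (I := Ioo (0:ℝ) 1)
    (S := {h : ℝ → ℝ | ContDiffOn ℝ ∞ h (Set.Ioo (0:ℝ) 1) ∧
      IsSemialgebraicFunOn ℚ {t : Fin 1 → ℝ | t 0 ∈ Set.Ioo (0:ℝ) 1} (fun t => h (t 0))})
    isOpen_Ioo (fun f hf g hfg => mem_S_congr hf hfg) zero_mem_S (fun f hf g hg => add_mem_S hf hg)
    (fun q f hf => ratMul_mem_S q hf) (fun f hf => mulX_mem_S hf) (fun f hf => deriv_mem_S hf)
    D w hwd hwderiv hsum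
  -- specialisation at `ϖ₀`: `Σ_e ϖ₀^e w_e = Σ mᵢ Pᵢ`
  have hspec : (fun x => ∑ i, (m i : ℝ) * P i x) ∈ {h : ℝ → ℝ | ContDiffOn ℝ ∞ h (Set.Ioo (0:ℝ) 1) ∧ IsSemialgebraicFunOn ℚ {t : Fin 1 → ℝ | t 0 ∈ Set.Ioo (0:ℝ) 1} (fun t => h (t 0))} := by
    have h1 : (fun x => ∑ e ∈ Finset.range (D + 1), ((ϖ₀ ^ e : ℚ) : ℝ) * w e x) ∈ {h : ℝ → ℝ | ContDiffOn ℝ ∞ h (Set.Ioo (0:ℝ) 1) ∧ IsSemialgebraicFunOn ℚ {t : Fin 1 → ℝ | t 0 ∈ Set.Ioo (0:ℝ) 1} (fun t => h (t 0))} :=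
      sum_mem_S _ fun e he => ratMul_mem_S _ (hkey e (Nat.lt_succ_iff.mp (Finset.mem_range.mp he)))
    refine mem_S_congr h1 fun x _ => ?_
    simp only [hw, mul_sub, Finset.sum_sub_distrib, mul_ite, mul_zero, Finset.sum_ite_eq',
      Finset.mem_range, Nat.zero_lt_succ, if_true, pow_zero, Rat.cast_pow, one_mul]
    simp only [Finset.mul_sum]
    rw [Finset.sum_comm]
    have : ∑ j, ∑ e ∈ Finset.range (D + 1), ((ϖ₀ : ℝ)) ^ e * ((ν j).coeff e * Q j x) =
        ∑ j, (ν j).eval (ϖ₀ : ℝ) * Q j x := Finset.sum_congr rfl fun j _ => by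
      rw [hνsum j, Finset.sum_mul]
      exact Finset.sum_congr rfl fun e _ => by ring
    rw [this]
    simp [hνeval0]
  have hfin : (fun x => (m₀ : ℝ) * x + ∑ i, (m i : ℝ) * P i x) ∈ {h : ℝ → ℝ | ContDiffOn ℝ ∞ h (Set.Ioo (0:ℝ) 1) ∧ IsSemialgebraicFunOn ℚ {t : Fin 1 → ℝ | t 0 ∈ Set.Ioo (0:ℝ) 1} (fun t => h (t 0))} :=
    add_mem_S (mem_S_congr (ratMul_mem_S (m₀ : ℚ) id_mem_S) fun x _ => by push_cast; ring) hspec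
  exact hfin.2

end Summit.KontsevichZagierPeriods.LiftingCriteria.DilationTransferDimOne
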